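import Summits.ResolutionOfSingularities.ResolutionOfSingularities.Theorems.FrobeniusClosingSteerQuadraticTransformResiduallyFinite
import Mathlib.FieldTheory.PrimitiveElement
import HarnessLib

/-!
# [OURS · L0 W4.1] K3ᴳ (F2): the TOP of an ℕ-chain of dominated local subrings and the separable STAGE A′
# (chain W4.1 `FrobeniusClosingSteer`, crux stmt-ResolutionOfSingularities-16345; K3ᴳ = `K3GTarget.horizonBaseChange`, res-L0-w41-stub-2 signature
# 8151858124874f54; `--supports … --as helper`)

HONEST FRAMING. OURS kernel (HIRONAKA-L librarian res-D-lib-1 gen 8). Two inputs of the horizon base change: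
* §1 for a chain `S 0 ≤ S 1 ≤ ⋯ ⊆ L` of local subrings, each step DOMINATED (`S i ≤ S j` for `i ≤ j` is the tree's `PersistentChainValued.le_of_le` / `monotone_nat_of_le_succ`): `dominates_of_le` (all pairs), the union `⨆ m, S m` is a LOCAL subring
  (`mem_iSup_iff`, `isLocalRing_iSup`) dominating every member (`dominates_iSup`) — its residue field is the uniform target of the kernels `𝔫ₘ` of the
  tower (the rôle `κ(S₃)` played for the 4-window of `…EtaleWindowLift`);
* §2 `exists_monic_lift_primitive_of_isSeparable` — stage A of `…QuadraticTransformResiduallyFinite` with perfectness REPLACED by the hypotheses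
  «`κ` finite separable over `κ(R₀)`» (in K3ᴳ separability comes from odd residue degrees, not from a perfect base): a primitive element `θ`, a monic lift
  `P ∈ R₀[X]` of its minimal polynomial (irreducible separable reduction), `P(θ) = 0`, and every element of `κ` a polynomial in `θ` with coefficients from `R₀`.
Nothing here is a statement of H. Hironaka's manuscript [Hironaka2017]. AI-written; AI review is weaker than expert review. [folklore]
-/

set_option linter.dupNamespace false

noncomputable section

namespace Summit.ResolutionOfSingularities.ResolutionOfSingularities.Theorems.SwitchingDichotomy.EtaleTower

open IsLocalRing Polynomial Literature.AlgebraicGeometry.Resolution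
open Summit.ResolutionOfSingularities.ResolutionOfSingularities.Theorems.SwitchingDichotomy.EtaleLift

/-! ## §1 The top of a dominated chain -/

section Chain

variable {L : Type} [Field L] (S : ℕ → Subring L)

/-- Domination along the chain. [folklore] -/
theorem dominates_of_le (hdom : ∀ m, SubringDominates (S m) (S (m + 1))) {i j : ℕ} (hij : i ≤ j) :
    SubringDominates (S i) (S j) := by
  induction j, hij using Nat.le_induction with
  | base => exact SubringDominates.refl _
  | succ j _ ih => exact ih.trans (hdom j)

/-- Membership in the union of the chain. [folklore] -/
theorem mem_iSup_iff (hle : ∀ m, S m ≤ S (m + 1)) {x : L} : x ∈ (⨆ m, S m) ↔ ∃ m, x ∈ S m :=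
  Subring.mem_iSup_of_directed (monotone_nat_of_le_succ hle).directed_le

/-- Every member lies in the union. [folklore] -/
theorem le_iSup' (m : ℕ) : S m ≤ ⨆ m, S m := le_iSup S m

/-- **The union dominates every member.** [folklore] -/
theorem dominates_iSup (hle : ∀ m, S m ≤ S (m + 1)) (hdom : ∀ m, SubringDominates (S m) (S (m + 1))) (m : ℕ) :
    SubringDominates (S m) (⨆ m, S m) := by
  refine ⟨le_iSup S m, fun x hx hinv => ?_⟩
  obtain ⟨n, hn⟩ := (mem_iSup_iff S hle).mp hinv
  exact (dominates_of_le S hdom (le_max_left m n)).2 x hx (monotone_nat_of_le_succ hle (le_max_right m n) hn)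

/-- A non-unit of a member stays a non-unit in the union (domination). [folklore] -/
theorem inv_not_mem_iSup (hle : ∀ m, S m ≤ S (m + 1)) (hdom : ∀ m, SubringDominates (S m) (S (m + 1))) {m : ℕ} {x : L}
    (hx : x ∈ S m) (hinv : x⁻¹ ∉ S m) : x⁻¹ ∉ (⨆ m, S m) :=
  fun h => hinv ((dominates_iSup S hle hdom m).2 x hx h)

/-- **The union of a dominated chain of local subrings is local.** [folklore] -/
theorem isLocalRing_iSup [∀ m, IsLocalRing (S m)] (hle : ∀ m, S m ≤ S (m + 1)) (hdom : ∀ m, SubringDominates (S m) (S (m + 1))) :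
    IsLocalRing (⨆ m, S m : Subring L) := by
  refine IsLocalRing.of_nonunits_add ?_
  intro a b ha hb hab
  -- read `a`, `b` in a common member `S n`
  obtain ⟨i, hi⟩ := (mem_iSup_iff S hle).mp a.2
  obtain ⟨j, hj⟩ := (mem_iSup_iff S hle).mp b.2
  set n := max i j
  have hai : (a : L) ∈ S n := monotone_nat_of_le_succ hle (le_max_left i j) hi
  have hbj : (b : L) ∈ S n := monotone_nat_of_le_succ hle (le_max_right i j) hj
  -- non-units of the union are non-units of `S n`
  have key : ∀ (c : (⨆ m, S m : Subring L)) (hc : (c : L) ∈ S n), c ∈ nonunits _ → (⟨(c : L), hc⟩ : S n) ∈ nonunits (S n) := by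
    intro c hc hcn hcu
    apply hcn
    rw [isUnit_subring_iff_inv_mem] at hcu ⊢
    exact ⟨hcu.1, le_iSup S n hcu.2⟩
  have ha' := key a hai ha
  have hb' := key b hbj hb
  have hsum : (⟨(a : L), hai⟩ : S n) + ⟨(b : L), hbj⟩ ∈ nonunits (S n) := IsLocalRing.nonunits_add ha' hb'
  apply hsum
  rw [isUnit_subring_iff_inv_mem] at hab ⊢
  refine ⟨hab.1, ?_⟩
  have hmem : ((a : L) + b) ∈ S n := (S n).add_mem hai hbj
  exact (dominates_iSup S hle hdom n).2 _ hmem hab.2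

end Chain

/-! ## §2 Stage A′: primitive element and monic lift, from finiteness + separability -/

/-- **Stage A′.** `R₀` local, `κ` a field, finite and separable over `κ(R₀)`: a primitive element `θ ∈ κ`, a monic `P ∈ R₀[X]` whose reduction is the
minimal polynomial of `θ` (irreducible, separable), `P(θ) = 0` through `κ(R₀) → κ`, and every `y ∈ κ` is `q(θ)` for some `q ∈ R₀[X]`. [folklore] -/
theorem exists_monic_lift_primitive_of_isSeparable {R₀ : Type} [CommRing R₀] [IsLocalRing R₀] {κ : Type} [Field κ]
    [Algebra (ResidueField R₀) κ] [Module.Finite (ResidueField R₀) κ] [Algebra.IsSeparable (ResidueField R₀) κ] :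
    ∃ (P : R₀[X]) (θ : κ), P.Monic ∧ Irreducible (P.map (residue R₀)) ∧ (P.map (residue R₀)).Separable ∧
      P.eval₂ ((algebraMap (ResidueField R₀) κ).comp (residue R₀)) θ = 0 ∧
      ∀ y : κ, ∃ q : R₀[X], y = q.eval₂ ((algebraMap (ResidueField R₀) κ).comp (residue R₀)) θ := by
  -- primitive element and its minimal polynomial
  obtain ⟨θ, hθ⟩ := Field.exists_primitive_element (ResidueField R₀) κ
  have hint : IsIntegral (ResidueField R₀) θ := Algebra.IsIntegral.isIntegral θ
  set m := minpoly (ResidueField R₀) θ with hm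
  have hmon : m.Monic := minpoly.monic hint
  -- lift `m` to a monic `P ∈ R₀[X]`
  have hlifts : m ∈ Polynomial.lifts (residue R₀) := by
    rw [Polynomial.mem_lifts]
    exact Polynomial.map_surjective (residue R₀) residue_surjective m
  obtain ⟨P, hPm, -, hPmon⟩ := Polynomial.lifts_and_degree_eq_and_monic hlifts hmon
  refine ⟨P, θ, hPmon, ?_, ?_, ?_, ?_⟩
  · rw [hPm]; exact minpoly.irreducible hint
  · rw [hPm]; exact Algebra.IsSeparable.isSeparable (ResidueField R₀) θ
  · rw [← Polynomial.eval₂_map, hPm]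
    change Polynomial.aeval θ m = 0
    exact minpoly.aeval _ θ
  · intro y
    have hy : y ∈ (Algebra.adjoin (ResidueField R₀) {θ} : Subalgebra (ResidueField R₀) κ) := by
      rw [← IntermediateField.adjoin_simple_toSubalgebra_of_isAlgebraic (hint.isAlgebraic), hθ]
      trivial
    rw [Algebra.adjoin_singleton_eq_range_aeval] at hy
    obtain ⟨q, hq⟩ := hy
    obtain ⟨q₀, hq₀⟩ := Polynomial.map_surjective (residue R₀) residue_surjective q
    refine ⟨q₀, ?_⟩
    rw [← Polynomial.eval₂_map, hq₀, ← hq]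
    rfl

end Summit.ResolutionOfSingularities.ResolutionOfSingularities.Theorems.SwitchingDichotomy.EtaleTower

end
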